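import Summits.QuantumFields.BalabanUV.T4Continuum.Support.NE9Lemma1PieceClass

/-!
# NE9Lemma1PieceClassTwoRate — the TWO-RATE class-relative per-piece binder of leaf S5 (input tree-decay rate κ, output rate
# κ′ ≤ κ) and the S5 leaf from it: the shape needed by the species of [I] §4, whose per-piece bound (4.22) p. 286 spends part of
# the input's κd_j(X) on the point sums («exp(−⅓κd_j(X))» from «exp(−κd_j(X))»)
# (cell `pub-balaban`, T4-DAG §2 node U3 / §6 NE9; lineage t4-ne9-p1 = row NE9 OWNER, generation 25; companion of
# `NE9Lemma1KernelSpecies`)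

HONEST FRAMING (T4-DAG PAGE 1).  Rung (B)+1 of the FINITE-VOLUME T⁴ programme — NOT infinite volume, NOT a mass gap, NOT the
Clay problem.  NE9 (`T4OutputRate.NE9` ∧ `FadingMemory`) is a cell NEW ESTIMATE, NOT PRINTED, NOT discharged here; spine 0/9.
HONEST DEPENDENCY (cell line, verbatim): continuum YM on T⁴ ⇐ BetaPertH ∧ nine spine estimates (0/9 proved); BetaPertH ⇐ (D1)
∧ (D4) ∧ CAP+tail; G-an2-4 gates asym, D1 and NE2/3/4.  `FlowStep.BetaPertH`, (B), (B^μ) do not occur.  [I] = [Balaban1987RG1]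
(CMP **109**), [II] = [Balaban1988RG2Cluster] (CMP **116**) are quoted for TYPES only (ABSOLUTE RULE: nothing printed in the
audited series is asserted).

WHAT THIS FILE IS.  Gen 24's `NE9Lemma1PieceClass.PieceBoundOnG Adm P κ κ₁ d₀ Kp gain` has ONE rate κ: the hypothesis bounds the
creation-step-j slice of the input family by `e^{−κd}·N` and the conclusion carries `e^{−κd(x)}`, consumed by the fibre sums
`LevelCountsG.sumX` (Σ_{X⊃□′}e^{−κd_j(X)} ≤ O(1), [II] (1.28)).  The frame's `ChannelSizeAtStepNN Adm T κ wt τ` carries κ in its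
HYPOTHESIS only (the output weight `wt` is κ-free), so a species whose per-piece bound LOSES tree-decay rate — [I] (4.22) p. 286:
*"Σ_{x,x₃}(8B₃α₁α₂⁻¹)⁴E₀exp(−⅓κd_j(X) − δ₁|x−x₀| − δ₁|x₃−x|)|x₃−x|(L^jη)⁵ … the decay rate is rather poor, δ₁ = O(M⁻¹), because
of the factor with κd_j(X)"* — still yields S5 provided the level counts are taken at the OUTPUT rate.  Kernel (0 sorry):
**`PieceBoundOnG₂ Adm P κ κ′ κ₁ d₀ Kp gain`** (hypothesis at κ, conclusion at κ′), `pieceBoundOnG₂_of_pieceBoundOnG` (κ′ = κ is gen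
24's binder), `abs_cstepBlock_le₂`, **`channelSizeAtStepNN_cpieceG₂`**: `PieceZero` → `PieceLocal` → `CSrcScale` → `PieceBoundOnG₂
Adm P κ κ′ …` → `LevelCountsG P.frame κ′ …` → `ChannelSizeAtStepNN Adm (cpieceChannel P) κ (weightOf P.frame κ₁ d₀ O1 Kp) (tauOfG
c_Q ℓ)` (`NE9Lemma1Gain.levels_boundG` BY NAME).  DISGUISE TEST: bookkeeping over one input family; not NE9.

References (TYPES only): [Balaban1987RG1] T. Bałaban, CMP **109** (1987) 249–301, (4.22) p. 286; [Balaban1988RG2Cluster]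
T. Bałaban, CMP **116** (1988) 1–22, (1.24)–(1.29) pp. 7–8.  Summits-side NEW work (LEAN PLACEMENT RULE); imports
`NE9Lemma1PieceClass` BY NAME; modifies nothing; 0 sorry.  Value = bookkeeping, NOT summit progress.
-/

noncomputable section

namespace Summit.QuantumFields.BalabanUV.T4Continuum.NE9Lemma1PieceClassTwoRate

open scoped BigOperators
open Literature.MathematicalPhysics.QuantumFieldTheory.Balaban1983to89
open Literature.MathematicalPhysics.QuantumFieldTheory.Balaban1983to89.T4OutputRate
open Literature.MathematicalPhysics.QuantumFieldTheory.Balaban1983to89.T4HistoryLipschitzRecursion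
open Summit.QuantumFields.BalabanUV.T4Continuum.NE9Lemma1Counting
open Summit.QuantumFields.BalabanUV.T4Continuum.NE9Lemma1Gain
open Summit.QuantumFields.BalabanUV.T4Continuum.NE9Lemma1PieceClass

/-! ## §1 The two-rate per-piece binder and leaf S5 from it -/

section TwoRate

variable {C : Carriers} {Bg ι α β γ : Type}

/-- **THE TWO-RATE PER-PIECE BOUND (class-relative, general gain)**: as gen 24's `PieceBoundOnG`, but the conclusion's tree
decay is taken at an OUTPUT rate `κ′` that may be smaller than the INPUT rate `κ` of the hypothesis — the shape of [I] (4.22)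
p. 286 (*"exp(−⅓κd_j(X))"* from an input with *"exp(−κd_j(X))"*: part of the decay pays for the point sums).
[cite: Balaban1987RG1, (4.22) p.286] -/
def PieceBoundOnG₂ (Adm : Set (Bg → C.Dom → ℝ)) (P : CPieceData C Bg ι α β γ) (κ κ' κ₁ d0 : ℝ) (Kp : ℕ → ι → ℝ)
    (gain : ℕ → ℕ → ℝ) : Prop :=
  ∀ (k : ℕ) (s : ℕ → ℝ) (y : ι), ∀ a ∈ P.S0 k y, ∀ b ∈ P.SY k y a, ∀ (j : ℕ), ∀ x ∈ P.src k y a j,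
    ∀ H ∈ Adm, ∀ (N : ℝ), 0 ≤ N →
      (∀ (U : Bg) (X : C.Dom), C.scale X = j → |H U X| ≤ Real.exp (-(κ * C.d X)) * N) →
        |P.piece k s y a b x H| ≤ Kp k y * N * gain k j * Real.exp (-(κ' * C.d x)) *
          Real.exp (-(1 / 8) * (κ₁ - 1) * P.dY k y + (1 / 8) * κ₁ * d0 - (1 / 2) * (κ₁ - 1) * P.vol k y a b)

/-- Gen 24's one-rate binder is the case κ′ = κ. [folklore] -/
theorem pieceBoundOnG₂_of_pieceBoundOnG {Adm : Set (Bg → C.Dom → ℝ)} {P : CPieceData C Bg ι α β γ} {κ κ₁ d0 : ℝ}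
    {Kp : ℕ → ι → ℝ} {gain : ℕ → ℕ → ℝ} (h : PieceBoundOnG Adm P κ κ₁ d0 Kp gain) :
    PieceBoundOnG₂ Adm P κ κ κ₁ d0 Kp gain :=
  h

/-- The step-j block of an admissible family of size `N·e^{−κd}` at scale j is bounded by `weightOf · (tauOfG · N)` when the
level counts are taken at the OUTPUT rate κ′ (`NE9Lemma1Gain.levels_boundG` on the index frame). [folklore] -/
theorem abs_cstepBlock_le₂ {P : CPieceData C Bg ι α β γ} {Adm : Set (Bg → C.Dom → ℝ)} {κ κ' κ₁ d0 O1 cQ : ℝ}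
    {Kp : ℕ → ι → ℝ} {gain ℓ : ℕ → ℕ → ℝ} (hPiece : PieceBoundOnG₂ Adm P κ κ' κ₁ d0 Kp gain)
    (hL : LevelCountsG P.frame κ' κ₁ O1 cQ gain ℓ) (hKp : ∀ k y, 0 ≤ Kp k y) (hO1 : 0 ≤ O1)
    (hgain : ∀ k j, 0 ≤ gain k j) (hcQℓ : ∀ k j, 0 ≤ cQ * ℓ k j) (k j : ℕ) (s : ℕ → ℝ) (y : ι)
    {H : Bg → C.Dom → ℝ} (hH : H ∈ Adm) {N : ℝ} (hN : 0 ≤ N)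
    (hbd : ∀ (U : Bg) (X : C.Dom), C.scale X = j → |H U X| ≤ Real.exp (-(κ * C.d X)) * N) :
    |cstepBlock P k s H y j| ≤ weightOf P.frame κ₁ d0 O1 Kp k y * (tauOfG cQ ℓ k j * N) := by
  have h1 : |cstepBlock P k s H y j| ≤ ∑ a ∈ P.S0 k y, ∑ b ∈ P.SY k y a,
      ∑ x ∈ P.src k y a j, |P.piece k s y a b x H| := by
    simp only [cstepBlock]
    refine (Finset.abs_sum_le_sum_abs _ _).trans (Finset.sum_le_sum fun a _ => ?_)
    refine (Finset.abs_sum_le_sum_abs _ _).trans (Finset.sum_le_sum fun b _ => ?_)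
    exact Finset.abs_sum_le_sum_abs _ _
  have h2 := levels_boundG P.frame hL (mul_nonneg (hKp k y) hN) hO1 hgain hcQℓ k y j
    (fun a b x => |P.piece k s y a b x H|) (fun a _ b _ x _ => abs_nonneg _)
    (fun a ha b hb x hx => hPiece k s y a ha b hb j x hx H hH N hN hbd)
  calc |cstepBlock P k s H y j| ≤ _ := h1
    _ ≤ Kp k y * N * O1 * (cQ * ℓ k j) * Real.exp 1 * Real.exp ((1 / 8) * κ₁ * d0) *
          Real.exp (-(1 / 16) * κ₁ * P.frame.dY k y) := h2
    _ = weightOf P.frame κ₁ d0 O1 Kp k y * (tauOfG cQ ℓ k j * N) := by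
        simp only [weightOf, tauOfG]; ring

/-- **LEAF S5 FOR A TWO-RATE PIECE FORM**: `ChannelSizeAtStepNN Adm (cpieceChannel P) κ (weightOf P.frame κ₁ d₀ O1 Kp)
(tauOfG c_Q ℓ)` at the INPUT rate κ from `PieceBoundOnG₂ Adm P κ κ′ …` and the level counts AT THE OUTPUT RATE κ′ (the frame's
`ChannelSizeAtStepNN` carries κ in its hypothesis only; the output weight is κ-free). [cite: Balaban1988RG2Cluster, (1.24)-(1.29) pp.7-8] -/
theorem channelSizeAtStepNN_cpieceG₂ {P : CPieceData C Bg ι α β γ} {Adm : Set (Bg → C.Dom → ℝ)} {κ κ' κ₁ d0 O1 cQ : ℝ}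
    {Kp : ℕ → ι → ℝ} {gain ℓ : ℕ → ℕ → ℝ} (h0 : PieceZero P) (hloc : PieceLocal P) (hsrc : CSrcScale P)
    (hPiece : PieceBoundOnG₂ Adm P κ κ' κ₁ d0 Kp gain) (hL : LevelCountsG P.frame κ' κ₁ O1 cQ gain ℓ)
    (hKp : ∀ k y, 0 ≤ Kp k y) (hO1 : 0 ≤ O1) (hgain : ∀ k j, 0 ≤ gain k j) (hcQℓ : ∀ k j, 0 ≤ cQ * ℓ k j) :
    ChannelSizeAtStepNN Adm (cpieceChannel P) κ (weightOf P.frame κ₁ d0 O1 Kp) (tauOfG cQ ℓ) := by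
  intro k j hjk s H hH hsupp N hN hbd y
  rw [cpieceChannel_of_supported h0 hloc hsrc hjk s hsupp y]
  exact abs_cstepBlock_le₂ hPiece hL hKp hO1 hgain hcQℓ k j s y hH hN hbd

end TwoRate

end Summit.QuantumFields.BalabanUV.T4Continuum.NE9Lemma1PieceClassTwoRate
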